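import Summits.QuantumFields.BalabanUV.Beta.GAN24.ResolventFamilyJets
import Literature.MathematicalPhysics.QuantumFieldTheory.Balaban1983to89.Beta.LogDetHessian

/-!
# `BalabanUV.Beta.GAN24.ResolventFamilyPolarization` — binder row G-an2-4 ∕ (CONV-C), route R7 «TWO CURRENCIES», PART 165: THE ONE-LOOP POLARIZATION (1.20) OF A RESOLVENT-FORM
# FAMILY WITH BACKGROUND-INDEPENDENT CONSTRAINT IS «½·BUBBLE − ½·TADPOLE» OF ITS INSERTION WORDS AGAINST THE FLUCTUATION COVARIANCE:
# `Π_{ij} = polarization F i j = −½·tr(𝒢·Σ_{ij}) + ½·tr(𝒢·Σ_i·𝒢·Σ_j)`, `Σ_i = c⁻¹X_ic⁻¹`, `Σ_{ij} = c⁻¹X_ic⁻¹X_jc⁻¹ + c⁻¹X_jc⁻¹X_ic⁻¹ − c⁻¹(X_{ij} + X_{ji})c⁻¹`, `𝒢` the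
# fluctuation block of the bordered inverse (= `C(CᵀΣ₀C)⁻¹Cᵀ` for any kernel basis `C` of the constraint) — pv25's `OneLoop.polarization` ∕ `torusKernel` of the `Family`
# `B ↦ (Q̃, Σ(B))`, `Σ(B) = (Q·(D + Σ_i B_i•P_i)⁻¹·Q′)⁻¹ + S₀`, computed by an2's `LogDetHessian.Family.polarization_eq_trace` on PART 164's jets (unit b2b-balaban-gan24-p3, gen 57; v1)

NOT IN PRINT; OUR PROOF ([folklore] bookkeeping BY NAME over an2 ∕ pv09's `Beta.LogDetHessian` — `Family.polarization_eq_trace` (Jacobi's second-order formula for `log Z = −½ log|det K|`),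
`Family.dK_eq_fromBlocks ∕ d2K_eq_fromBlocks`, `LogDetHessian.trace_fromBlocks`, `LogDetHessian.kkt_inv_eq_blockInv` (the bordered inverse `[[𝒢, ℋ],[ℋ♭, −𝒮]]`, no
symmetry needed), pv23's `KKTBridge.kkt_det_ne_zero` — and PART 164 `ResolventFamilyJets` (`contDiffAt_effFormPencil_entry`, `of_fderiv_effFormPencil_entry_single`,
`of_hessianAt_effFormPencil_entry`).  [Balaban1987RG1] (1.20)–(1.21) p. 264 and (1.4) p. 260 LOCATE the objects («Π^{ab}_{j+1,μν}(g_j,x,x′) = (δ²∕δB^a_μ(x)δB^b_ν(x′) E^{(j+1)})(g_j,0)»,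
«Z^{(j)}(U_k) = ∫ dB δ(Q̃B) exp[−½⟨B, Δ^{(j)}(U_k)B⟩]»); nothing printed is a hypothesis.)
HONEST FRAMING (cell contract, verbatim): «discharging `BetaPertH` makes Bałaban's UV stability UNCONDITIONAL — a real constructive-QFT result; it is NOT the continuum limit and NOT the
Clay problem.»  HONEST DEPENDENCY (verbatim): «continuum YM on T⁴ ⇐ BetaPertH ∧ nine spine estimates (0/9 proved); BetaPertH ⇐ (D1) ∧ (D4) ∧ CAP+tail; G-an2-4 gates asym, D1 and NE2/3/4.»

WHY.  The β-cell consumes `LimitForm.conv : ∀ k, |S.β0 k − binf| ≤ c₀θ^k` for `β⁰_{k+1} = Σ_x Π⁰_{k+1,μν}(x) x_μx_ν` ((1.22); `OneLoopDictionary.beta0_eq`), `Π⁰_{k+1}` the infinite-volume limit of the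
torus kernels `torusKernel (model k t)` of a `Family` ((1.20)–(1.21), pv25's `OneLoop`).  Road P3's R7 × β-cell chain (PARTs 115–163) put every CONSTITUENT of the first-order model's effective
form `Σ_k(B)` — the form itself, every insertion word, every diagram, every Taylor coefficient in the background — in the β-cell's `LimitRate` currency on `ℤ^d`, but never the one-loop
functional (1.20) ITSELF.  Here the gap is closed at the level of exact finite-volume algebra, for EVERY family in resolvent form with a background-independent constraint `Q̃` (the
one-step averaging of [Balaban1987RG1] p. 267 «LQ̃h = I» at `U = 1` does not see the background): its one-loop polarization is an explicit `ℤ∕2`-combination of TWO loop diagrams —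
the TADPOLE `tr(𝒢·Σ_{ij})` of the mixed second jet and the BUBBLE `tr(𝒢·Σ_i·𝒢·Σ_j)` of the first jets — in the letters `𝒢` (fluctuation covariance of `(Σ₀, Q̃)`), `c⁻¹`, `X_i`, `X_{ij}`
(PART 164 identifies the jets with PART 159's words).  WHAT REMAINS for the model's `LimitForm.conv` literal is therefore located exactly: (a) the letter `𝒢 = C(CᵀΣ_kC)⁻¹Cᵀ` (the
two-level fluctuation covariance of the effective form under one-step averaging) in the INPUT-triple currency of PARTs 142 ∕ 156 ((UD) + (SR) + EL₂ — Combes–Thomas on the unit lattice as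
in PART 127, given a `k`-uniform coercivity of `Σ_k` on `ker Q̃`); (b) the loop contraction `(i, j) ↦ tr(…)` as a KERNEL on the unit lattice (PART 153's pair-window Tannery pattern);
(c) the real structure of the lineage's `ℂ`-typed towers.  None of (a)–(c) is claimed here.

WHAT THIS FILE PROVES (0 sorry, 0 `def`; `ι` the background index, `p` the fine index, `Fin n` ∕ `Fin m` the fluctuation ∕ constraint coordinates of pv25's `Family ι n m`; `D, P_i : p × p`,
`Q : n × p`, `Q′ : p × n`, `S₀ : n × n`, constraint `Q̃ : m × n`; `Σ(B) = (Q·(D + Σ_i B_i•P_i)⁻¹·Q′)⁻¹ + S₀`, `c = Q·D⁻¹·Q′`, `X_i = Q·D⁻¹P_iD⁻¹·Q′`, `X_{ij} = Q·D⁻¹P_iD⁻¹P_jD⁻¹·Q′`):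
* §1 `dQ_const ∕ d2Q_const` (a background-independent constraint has no jets), `kkt_zero` (the bordered matrix of the family at `B = 0`), `dΔ_resolventFamily ∕ d2Δ_resolventFamily` (PART 164's
  words ARE `Family.dΔ ∕ Family.d2Δ`), `contDiffAt_Q ∕ contDiffAt_Δ`.
* §2 **`polarization_resolventFamily_eq_trace`** — for `D`, `c` nonsingular and `det K₀ ≠ 0` (`K₀ = [[Σ₀, Q̃ᵀ],[Q̃, 0]]`, `Σ₀ = c⁻¹ + S₀`):
  `polarization F i j = −½·(tr(G·Σ_{ij}) − tr(G·Σ_i·G·Σ_j))`, `G = (K₀⁻¹)₁₁`; **`polarization_resolventFamily_eq_cov`** — the same with `G = 𝒢 = C(CᵀΣ₀C)⁻¹Cᵀ` (an2's `LogDetHessian.cov`) for ANY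
  kernel parametrisation `C : n × r` of `ker Q̃` (`Q̃C = 0`, `CᵀC`, `Q̃Q̃ᵀ`, `CᵀΣ₀C` nonsingular, `r + m = n`); **`polarization_resolventFamily_of_regular`** — under pv25's `Regular` at `B = 0`
  (onto `Q̃`, `Σ₀` symmetric and positive on `ker Q̃`) with `C : n × (n − m)` from pv23's `KKTBridge.exists_kernelBasis`, every nonsingularity DISCHARGED.
* §3 **`torusKernel_resolventFamily`** — the (1.21) reading `Π⁰_{μν}(x) = polarization F ((x,μ),a₀) ((0,ν),a₀)` of §2 for `ι = ExtIndex d s c`.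
WHAT IT IS NOT: no limit `T ↗ ℤ^d`, no rate, no instance on the lineage's `ℂ`-typed towers (items (a)–(c) above); NOT Bałaban's `Δ^{(k)}(U_{k+1}(exp iB))` ∕ covariant `Q̃(B)` (row an1's dictionary
— there `dQ ≠ 0` and all seven terms of an2's master formula (M) appear).  SUPPLIER work; NEVER «G-an2-4 closed»; NOT (CONV-C), NOT D1, NOT `BetaPertH`, NOT continuum, NOT Clay.
Records: `HOME/b2b-balaban-gan24-p3/gen57/README.md`.
-/

noncomputable section

open Matrix Topology Filter
open scoped BigOperators

namespace Summit.QuantumFields.BalabanUV.Beta.GAN24.ResolventFamilyPolarization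

open Literature.MathematicalPhysics.QuantumFieldTheory.Balaban1983to89.Beta
open Literature.MathematicalPhysics.QuantumFieldTheory.Balaban1983to89.Beta.LogDetHessian (cov trace_fromBlocks kkt_inv_eq_blockInv kkt_mul_blockInv blockInv)
open Summit.QuantumFields.BalabanUV.Beta.GAN24.ResolventFamilyJets (pencil_zero contDiffAt_effFormPencil_entry of_fderiv_effFormPencil_entry_single of_hessianAt_effFormPencil_entry)

variable {ι : Type*} [Fintype ι] [DecidableEq ι] {p : Type*} [Fintype p] [DecidableEq p] {n m : ℕ}

/-! ## §1 The jets of the resolvent-form family `B ↦ (Q̃, Σ(B))` -/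

omit [Fintype ι] in
/-- A background-independent constraint has no first jet: `Family.dQ = 0`. [folklore] -/
theorem dQ_const (Qc : Matrix (Fin m) (Fin n) ℝ) (Δ : (ι → ℝ) → Matrix (Fin n) (Fin n) ℝ) (i : ι) :
    Family.dQ (fun B : ι → ℝ => (⟨Qc, Δ B⟩ : ConstrainedGaussian n m)) i = 0 := by
  ext a b
  simp [Family.dQ]

/-- A background-independent constraint has no second jet: `Family.d2Q = 0`. [folklore] -/
theorem d2Q_const (Qc : Matrix (Fin m) (Fin n) ℝ) (Δ : (ι → ℝ) → Matrix (Fin n) (Fin n) ℝ) (i j : ι) :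
    Family.d2Q (fun B : ι → ℝ => (⟨Qc, Δ B⟩ : ConstrainedGaussian n m)) i j = 0 := by
  ext a b
  simp [Family.d2Q, hessianAt, iteratedFDeriv_const_of_ne (𝕜 := ℝ) (E := ι → ℝ) two_ne_zero (Qc a b)]

omit [DecidableEq ι] in
/-- The constraint entries of the family are `C²` (constant). [folklore] -/
theorem contDiffAt_Q (Qc : Matrix (Fin m) (Fin n) ℝ) (Δ : (ι → ℝ) → Matrix (Fin n) (Fin n) ℝ) (a : Fin m) (b : Fin n) :
    ContDiffAt ℝ 2 (fun B : ι → ℝ => ((⟨Qc, Δ B⟩ : ConstrainedGaussian n m)).Q a b) 0 :=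
  contDiffAt_const

omit [DecidableEq ι] in
/-- The form entries of the resolvent-form family are `C²` at `B = 0` (PART 164 `contDiffAt_effFormPencil_entry`). [folklore] -/
theorem contDiffAt_Δ (D : Matrix p p ℝ) (P : ι → Matrix p p ℝ) (Q : Matrix (Fin n) p ℝ) (Q' : Matrix p (Fin n) ℝ) (S₀ : Matrix (Fin n) (Fin n) ℝ)
    (Qc : Matrix (Fin m) (Fin n) ℝ) (hD : IsUnit D.det) (hc : IsUnit (Q * D⁻¹ * Q').det) (a b : Fin n) :
    ContDiffAt ℝ 2 (fun B : ι → ℝ => ((⟨Qc, (Q * (D + ∑ i, B i • P i)⁻¹ * Q')⁻¹ + S₀⟩ : ConstrainedGaussian n m)).Δ a b) 0 :=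
  contDiffAt_effFormPencil_entry (k := 2) D P Q Q' S₀ hD hc a b

omit [DecidableEq ι] in
/-- The bordered matrix of the family at `B = 0` is `[[c⁻¹ + S₀, Q̃ᵀ],[Q̃, 0]]`, `c = Q·D⁻¹·Q′`. [folklore] -/
theorem kkt_zero (D : Matrix p p ℝ) (P : ι → Matrix p p ℝ) (Q : Matrix (Fin n) p ℝ) (Q' : Matrix p (Fin n) ℝ) (S₀ : Matrix (Fin n) (Fin n) ℝ)
    (Qc : Matrix (Fin m) (Fin n) ℝ) :
    ((fun B : ι → ℝ => (⟨Qc, (Q * (D + ∑ i, B i • P i)⁻¹ * Q')⁻¹ + S₀⟩ : ConstrainedGaussian n m)) 0).kkt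
      = Matrix.fromBlocks ((Q * D⁻¹ * Q')⁻¹ + S₀) Qcᵀ Qc 0 := by
  simp only [ConstrainedGaussian.kkt, pencil_zero]

/-- **`Family.dΔ` IS THE FIRST INSERTION WORD**: `dΔ i = c⁻¹·X_i·c⁻¹` (PART 164 `of_fderiv_effFormPencil_entry_single`). [folklore] -/
theorem dΔ_resolventFamily (D : Matrix p p ℝ) (P : ι → Matrix p p ℝ) (Q : Matrix (Fin n) p ℝ) (Q' : Matrix p (Fin n) ℝ) (S₀ : Matrix (Fin n) (Fin n) ℝ)
    (Qc : Matrix (Fin m) (Fin n) ℝ) (hD : IsUnit D.det) (hc : IsUnit (Q * D⁻¹ * Q').det) (i : ι) :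
    Family.dΔ (fun B : ι → ℝ => (⟨Qc, (Q * (D + ∑ i, B i • P i)⁻¹ * Q')⁻¹ + S₀⟩ : ConstrainedGaussian n m)) i
      = (Q * D⁻¹ * Q')⁻¹ * (Q * (D⁻¹ * P i * D⁻¹) * Q') * (Q * D⁻¹ * Q')⁻¹ :=
  of_fderiv_effFormPencil_entry_single D P Q Q' S₀ hD hc i

/-- **`Family.d2Δ` IS THE POLARISED SECOND INSERTION WORD**: `d2Δ i j = c⁻¹X_ic⁻¹X_jc⁻¹ + c⁻¹X_jc⁻¹X_ic⁻¹ − c⁻¹(X_{ij} + X_{ji})c⁻¹` (PART 164 `of_hessianAt_effFormPencil_entry`). [folklore] -/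
theorem d2Δ_resolventFamily (D : Matrix p p ℝ) (P : ι → Matrix p p ℝ) (Q : Matrix (Fin n) p ℝ) (Q' : Matrix p (Fin n) ℝ) (S₀ : Matrix (Fin n) (Fin n) ℝ)
    (Qc : Matrix (Fin m) (Fin n) ℝ) (hD : IsUnit D.det) (hc : IsUnit (Q * D⁻¹ * Q').det) (i j : ι) :
    Family.d2Δ (fun B : ι → ℝ => (⟨Qc, (Q * (D + ∑ i, B i • P i)⁻¹ * Q')⁻¹ + S₀⟩ : ConstrainedGaussian n m)) i j
      = (Q * D⁻¹ * Q')⁻¹ * (Q * (D⁻¹ * P i * D⁻¹) * Q') * (Q * D⁻¹ * Q')⁻¹ * (Q * (D⁻¹ * P j * D⁻¹) * Q') * (Q * D⁻¹ * Q')⁻¹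
        + (Q * D⁻¹ * Q')⁻¹ * (Q * (D⁻¹ * P j * D⁻¹) * Q') * (Q * D⁻¹ * Q')⁻¹ * (Q * (D⁻¹ * P i * D⁻¹) * Q') * (Q * D⁻¹ * Q')⁻¹
        - (Q * D⁻¹ * Q')⁻¹ * (Q * (D⁻¹ * P i * D⁻¹ * P j * D⁻¹ + D⁻¹ * P j * D⁻¹ * P i * D⁻¹) * Q') * (Q * D⁻¹ * Q')⁻¹ :=
  of_hessianAt_effFormPencil_entry D P Q Q' S₀ hD hc i j

/-! ## §2 The one-loop polarization: `−½·tr(G·Σ_{ij}) + ½·tr(G·Σ_i·G·Σ_j)` -/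

/-- **THE ONE-LOOP POLARIZATION OF A RESOLVENT-FORM FAMILY WITH BACKGROUND-INDEPENDENT CONSTRAINT** (general form): for `D`, `c = Q·D⁻¹·Q′` nonsingular and the bordered matrix
`K₀ = [[c⁻¹ + S₀, Q̃ᵀ],[Q̃, 0]]` nonsingular, with `G = (K₀⁻¹)₁₁` its fluctuation block,
`polarization F i j = −½·(tr(G·Σ_{ij}) − tr(G·Σ_i·G·Σ_j))` — an2's `Family.polarization_eq_trace` in which the constraint jets vanish (`dQ_const`, `d2Q_const`) and the form jets are PART 164's
insertion words (`dΔ_resolventFamily`, `d2Δ_resolventFamily`). [folklore] -/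
theorem polarization_resolventFamily_eq_trace (D : Matrix p p ℝ) (P : ι → Matrix p p ℝ) (Q : Matrix (Fin n) p ℝ) (Q' : Matrix p (Fin n) ℝ)
    (S₀ : Matrix (Fin n) (Fin n) ℝ) (Qc : Matrix (Fin m) (Fin n) ℝ) (hD : IsUnit D.det) (hc : IsUnit (Q * D⁻¹ * Q').det)
    (hK : (Matrix.fromBlocks ((Q * D⁻¹ * Q')⁻¹ + S₀) Qcᵀ Qc 0).det ≠ 0) (i j : ι) :
    polarization (fun B : ι → ℝ => (⟨Qc, (Q * (D + ∑ i, B i • P i)⁻¹ * Q')⁻¹ + S₀⟩ : ConstrainedGaussian n m)) i j =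
      -(1 / 2 : ℝ) * ((((Matrix.fromBlocks ((Q * D⁻¹ * Q')⁻¹ + S₀) Qcᵀ Qc 0)⁻¹).toBlocks₁₁
            * ((Q * D⁻¹ * Q')⁻¹ * (Q * (D⁻¹ * P i * D⁻¹) * Q') * (Q * D⁻¹ * Q')⁻¹ * (Q * (D⁻¹ * P j * D⁻¹) * Q') * (Q * D⁻¹ * Q')⁻¹
              + (Q * D⁻¹ * Q')⁻¹ * (Q * (D⁻¹ * P j * D⁻¹) * Q') * (Q * D⁻¹ * Q')⁻¹ * (Q * (D⁻¹ * P i * D⁻¹) * Q') * (Q * D⁻¹ * Q')⁻¹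
              - (Q * D⁻¹ * Q')⁻¹ * (Q * (D⁻¹ * P i * D⁻¹ * P j * D⁻¹ + D⁻¹ * P j * D⁻¹ * P i * D⁻¹) * Q') * (Q * D⁻¹ * Q')⁻¹)).trace
        - (((Matrix.fromBlocks ((Q * D⁻¹ * Q')⁻¹ + S₀) Qcᵀ Qc 0)⁻¹).toBlocks₁₁
            * ((Q * D⁻¹ * Q')⁻¹ * (Q * (D⁻¹ * P i * D⁻¹) * Q') * (Q * D⁻¹ * Q')⁻¹)
            * ((Matrix.fromBlocks ((Q * D⁻¹ * Q')⁻¹ + S₀) Qcᵀ Qc 0)⁻¹).toBlocks₁₁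
            * ((Q * D⁻¹ * Q')⁻¹ * (Q * (D⁻¹ * P j * D⁻¹) * Q') * (Q * D⁻¹ * Q')⁻¹)).trace) := by
  set F : Family ι n m := fun B : ι → ℝ => (⟨Qc, (Q * (D + ∑ i, B i • P i)⁻¹ * Q')⁻¹ + S₀⟩ : ConstrainedGaussian n m) with hF
  have hkkt : (F 0).kkt = Matrix.fromBlocks ((Q * D⁻¹ * Q')⁻¹ + S₀) Qcᵀ Qc 0 := kkt_zero D P Q Q' S₀ Qc
  have hdet : (F 0).kkt.det ≠ 0 := by rw [hkkt]; exact hK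
  rw [Family.polarization_eq_trace F (contDiffAt_Q Qc _) (contDiffAt_Δ D P Q Q' S₀ Qc hD hc) hdet i j,
    Family.dK_eq_fromBlocks, Family.dK_eq_fromBlocks, Family.d2K_eq_fromBlocks, hF, dQ_const, dQ_const, d2Q_const,
    dΔ_resolventFamily D P Q Q' S₀ Qc hD hc i, dΔ_resolventFamily D P Q Q' S₀ Qc hD hc j, d2Δ_resolventFamily D P Q Q' S₀ Qc hD hc i j, ← hF, hkkt,
    ← Matrix.fromBlocks_toBlocks (Matrix.fromBlocks ((Q * D⁻¹ * Q')⁻¹ + S₀) Qcᵀ Qc 0)⁻¹]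
  simp only [Matrix.fromBlocks_multiply, trace_fromBlocks, Matrix.toBlocks_fromBlocks₁₁, Matrix.mul_zero, Matrix.zero_mul, Matrix.trace_zero, add_zero,
    Matrix.transpose_zero]

/-- **THE SAME WITH THE FLUCTUATION COVARIANCE NAMED**: for ANY kernel parametrisation `C : n × r` of `ker Q̃` (`Q̃C = 0`; `CᵀC`, `Q̃Q̃ᵀ`, `CᵀΣ₀C` nonsingular; `e : Fin n ≃ Fin r ⊕ Fin m`), the fluctuation
block of `K₀⁻¹` is an2's `cov Σ₀ C = C(CᵀΣ₀C)⁻¹Cᵀ` (`LogDetHessian.kkt_inv_eq_blockInv`, NO symmetry of `Σ₀` needed), so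
`polarization F i j = −½·tr(𝒢·Σ_{ij}) + ½·tr(𝒢·Σ_i·𝒢·Σ_j)`, `𝒢 = C(CᵀΣ₀C)⁻¹Cᵀ` — «½·BUBBLE − ½·TADPOLE» of the insertion words against the fluctuation covariance of `(Σ₀, Q̃)`. [folklore] -/
theorem polarization_resolventFamily_eq_cov {r : ℕ} (D : Matrix p p ℝ) (P : ι → Matrix p p ℝ) (Q : Matrix (Fin n) p ℝ) (Q' : Matrix p (Fin n) ℝ)
    (S₀ : Matrix (Fin n) (Fin n) ℝ) (Qc : Matrix (Fin m) (Fin n) ℝ) (hD : IsUnit D.det) (hc : IsUnit (Q * D⁻¹ * Q').det)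
    (e : Fin n ≃ Fin r ⊕ Fin m) (C : Matrix (Fin n) (Fin r) ℝ) (hQC : Qc * C = 0) (hCC : IsUnit (Cᵀ * C).det) (hQQ : IsUnit (Qc * Qcᵀ).det)
    (hΓ : IsUnit (Cᵀ * ((Q * D⁻¹ * Q')⁻¹ + S₀) * C).det) (i j : ι) :
    polarization (fun B : ι → ℝ => (⟨Qc, (Q * (D + ∑ i, B i • P i)⁻¹ * Q')⁻¹ + S₀⟩ : ConstrainedGaussian n m)) i j =
      -(1 / 2 : ℝ) * (cov ((Q * D⁻¹ * Q')⁻¹ + S₀) C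
            * ((Q * D⁻¹ * Q')⁻¹ * (Q * (D⁻¹ * P i * D⁻¹) * Q') * (Q * D⁻¹ * Q')⁻¹ * (Q * (D⁻¹ * P j * D⁻¹) * Q') * (Q * D⁻¹ * Q')⁻¹
              + (Q * D⁻¹ * Q')⁻¹ * (Q * (D⁻¹ * P j * D⁻¹) * Q') * (Q * D⁻¹ * Q')⁻¹ * (Q * (D⁻¹ * P i * D⁻¹) * Q') * (Q * D⁻¹ * Q')⁻¹
              - (Q * D⁻¹ * Q')⁻¹ * (Q * (D⁻¹ * P i * D⁻¹ * P j * D⁻¹ + D⁻¹ * P j * D⁻¹ * P i * D⁻¹) * Q') * (Q * D⁻¹ * Q')⁻¹)).trace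
        + (1 / 2 : ℝ) * (cov ((Q * D⁻¹ * Q')⁻¹ + S₀) C * ((Q * D⁻¹ * Q')⁻¹ * (Q * (D⁻¹ * P i * D⁻¹) * Q') * (Q * D⁻¹ * Q')⁻¹)
            * cov ((Q * D⁻¹ * Q')⁻¹ + S₀) C * ((Q * D⁻¹ * Q')⁻¹ * (Q * (D⁻¹ * P j * D⁻¹) * Q') * (Q * D⁻¹ * Q')⁻¹)).trace := by
  have hinv := kkt_inv_eq_blockInv e ((Q * D⁻¹ * Q')⁻¹ + S₀) Qc C hQC hCC hQQ hΓ
  have hK : (Matrix.fromBlocks ((Q * D⁻¹ * Q')⁻¹ + S₀) Qcᵀ Qc 0).det ≠ 0 := by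
    intro h0
    have hmul := kkt_mul_blockInv e ((Q * D⁻¹ * Q')⁻¹ + S₀) Qc C hQC hCC hQQ hΓ
    have hd := congrArg Matrix.det hmul
    rw [Matrix.det_mul, h0, zero_mul, Matrix.det_one] at hd
    exact zero_ne_one hd
  have h11 : ((Matrix.fromBlocks ((Q * D⁻¹ * Q')⁻¹ + S₀) Qcᵀ Qc 0)⁻¹).toBlocks₁₁ = cov ((Q * D⁻¹ * Q')⁻¹ + S₀) C := by
    rw [hinv, blockInv, Matrix.toBlocks_fromBlocks₁₁]
  rw [polarization_resolventFamily_eq_trace D P Q Q' S₀ Qc hD hc hK i j, h11]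
  ring

/-- **THE SAME UNDER REGULARITY OF THE BASE POINT** (pv25's `ConstrainedGaussian.Regular`: `Q̃` onto, `Σ₀ = c⁻¹ + S₀` symmetric and positive on `ker Q̃` — the hypotheses pv25's `OneLoopDictionary.regular`
places on a background family): with a kernel basis `C` of `ker Q̃` from pv23's `KKTBridge.exists_kernelBasis`, every nonsingularity of `polarization_resolventFamily_eq_cov` is DISCHARGED
(`KKTBridge.gram_posDef ∕ constraintGram_posDef ∕ reduced_posDef`), and `𝒢 = C(CᵀΣ₀C)⁻¹Cᵀ` is then the symmetric constrained covariance. [folklore] -/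
theorem polarization_resolventFamily_of_regular (D : Matrix p p ℝ) (P : ι → Matrix p p ℝ) (Q : Matrix (Fin n) p ℝ) (Q' : Matrix p (Fin n) ℝ)
    (S₀ : Matrix (Fin n) (Fin n) ℝ) (Qc : Matrix (Fin m) (Fin n) ℝ) (hD : IsUnit D.det) (hc : IsUnit (Q * D⁻¹ * Q').det)
    (hreg : ((⟨Qc, (Q * D⁻¹ * Q')⁻¹ + S₀⟩ : ConstrainedGaussian n m)).Regular) (i j : ι) :
    ∃ C : Matrix (Fin n) (Fin (n - m)) ℝ, Qc * C = 0 ∧ Function.Injective C.mulVec ∧ n - m + m = n ∧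
      polarization (fun B : ι → ℝ => (⟨Qc, (Q * (D + ∑ i, B i • P i)⁻¹ * Q')⁻¹ + S₀⟩ : ConstrainedGaussian n m)) i j =
        -(1 / 2 : ℝ) * (cov ((Q * D⁻¹ * Q')⁻¹ + S₀) C
              * ((Q * D⁻¹ * Q')⁻¹ * (Q * (D⁻¹ * P i * D⁻¹) * Q') * (Q * D⁻¹ * Q')⁻¹ * (Q * (D⁻¹ * P j * D⁻¹) * Q') * (Q * D⁻¹ * Q')⁻¹
                + (Q * D⁻¹ * Q')⁻¹ * (Q * (D⁻¹ * P j * D⁻¹) * Q') * (Q * D⁻¹ * Q')⁻¹ * (Q * (D⁻¹ * P i * D⁻¹) * Q') * (Q * D⁻¹ * Q')⁻¹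
                - (Q * D⁻¹ * Q')⁻¹ * (Q * (D⁻¹ * P i * D⁻¹ * P j * D⁻¹ + D⁻¹ * P j * D⁻¹ * P i * D⁻¹) * Q') * (Q * D⁻¹ * Q')⁻¹)).trace
          + (1 / 2 : ℝ) * (cov ((Q * D⁻¹ * Q')⁻¹ + S₀) C * ((Q * D⁻¹ * Q')⁻¹ * (Q * (D⁻¹ * P i * D⁻¹) * Q') * (Q * D⁻¹ * Q')⁻¹)
              * cov ((Q * D⁻¹ * Q')⁻¹ + S₀) C * ((Q * D⁻¹ * Q')⁻¹ * (Q * (D⁻¹ * P j * D⁻¹) * Q') * (Q * D⁻¹ * Q')⁻¹)).trace := by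
  obtain ⟨C, hQC, hC, hr⟩ := KKTBridge.exists_kernelBasis Qc hreg.onto
  have hCC : IsUnit (Cᵀ * C).det := isUnit_iff_ne_zero.2 (KKTBridge.gram_posDef C hC).det_pos.ne'
  have hQQ : IsUnit (Qc * Qcᵀ).det := isUnit_iff_ne_zero.2 (KKTBridge.constraintGram_posDef Qc hreg.onto).det_pos.ne'
  have hΓ : IsUnit (Cᵀ * ((Q * D⁻¹ * Q')⁻¹ + S₀) * C).det :=
    isUnit_iff_ne_zero.2 (KKTBridge.reduced_posDef (⟨Qc, (Q * D⁻¹ * Q')⁻¹ + S₀⟩ : ConstrainedGaussian n m) C hreg.symm hreg.posKer hQC hC).det_pos.ne'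
  have e : Fin n ≃ Fin (n - m) ⊕ Fin m := (finSumFinEquiv.trans (finCongr hr)).symm
  exact ⟨C, hQC, hC, hr, polarization_resolventFamily_eq_cov D P Q Q' S₀ Qc hD hc e C hQC hCC hQQ hΓ i j⟩

/-! ## §3 The (1.21) reading on the torus index `ι = ExtIndex d s c` -/

/-- **THE TORUS ONE-LOOP KERNEL OF A RESOLVENT-FORM FAMILY** ((1.21) p. 264 read on the torus, pv25's `torusKernel`): for the background index `ι = ExtIndex d s c` (bond `(x, μ)`, colour `a`),
`Π⁰_{μν}(x) = torusKernel F a₀ μ ν x = −½·tr(𝒢·Σ_{ij}) + ½·tr(𝒢·Σ_i·𝒢·Σ_j)` at `i = ((x, μ), a₀)`, `j = ((0, ν), a₀)` — `polarization_resolventFamily_eq_cov` at these indices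
(`torusKernel` is `polarization` there by definition). [cite: Balaban1987RG1, (1.21) p.264] [folklore] -/
theorem torusKernel_resolventFamily {d s c r : ℕ} [NeZero s] (D : Matrix p p ℝ) (P : ExtIndex d s c → Matrix p p ℝ) (Q : Matrix (Fin n) p ℝ)
    (Q' : Matrix p (Fin n) ℝ) (S₀ : Matrix (Fin n) (Fin n) ℝ) (Qc : Matrix (Fin m) (Fin n) ℝ) (hD : IsUnit D.det) (hc : IsUnit (Q * D⁻¹ * Q').det)
    (e : Fin n ≃ Fin r ⊕ Fin m) (C : Matrix (Fin n) (Fin r) ℝ) (hQC : Qc * C = 0) (hCC : IsUnit (Cᵀ * C).det) (hQQ : IsUnit (Qc * Qcᵀ).det)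
    (hΓ : IsUnit (Cᵀ * ((Q * D⁻¹ * Q')⁻¹ + S₀) * C).det) (a₀ : Fin c) (μ ν : Fin d) (x : Site d s) :
    torusKernel (fun B : ExtIndex d s c → ℝ => (⟨Qc, (Q * (D + ∑ i, B i • P i)⁻¹ * Q')⁻¹ + S₀⟩ : ConstrainedGaussian n m)) a₀ μ ν x =
      -(1 / 2 : ℝ) * (cov ((Q * D⁻¹ * Q')⁻¹ + S₀) C
            * ((Q * D⁻¹ * Q')⁻¹ * (Q * (D⁻¹ * P ((x, μ), a₀) * D⁻¹) * Q') * (Q * D⁻¹ * Q')⁻¹ * (Q * (D⁻¹ * P ((0, ν), a₀) * D⁻¹) * Q') * (Q * D⁻¹ * Q')⁻¹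
              + (Q * D⁻¹ * Q')⁻¹ * (Q * (D⁻¹ * P ((0, ν), a₀) * D⁻¹) * Q') * (Q * D⁻¹ * Q')⁻¹ * (Q * (D⁻¹ * P ((x, μ), a₀) * D⁻¹) * Q') * (Q * D⁻¹ * Q')⁻¹
              - (Q * D⁻¹ * Q')⁻¹ * (Q * (D⁻¹ * P ((x, μ), a₀) * D⁻¹ * P ((0, ν), a₀) * D⁻¹ + D⁻¹ * P ((0, ν), a₀) * D⁻¹ * P ((x, μ), a₀) * D⁻¹) * Q')
                * (Q * D⁻¹ * Q')⁻¹)).trace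
        + (1 / 2 : ℝ) * (cov ((Q * D⁻¹ * Q')⁻¹ + S₀) C * ((Q * D⁻¹ * Q')⁻¹ * (Q * (D⁻¹ * P ((x, μ), a₀) * D⁻¹) * Q') * (Q * D⁻¹ * Q')⁻¹)
            * cov ((Q * D⁻¹ * Q')⁻¹ + S₀) C * ((Q * D⁻¹ * Q')⁻¹ * (Q * (D⁻¹ * P ((0, ν), a₀) * D⁻¹) * Q') * (Q * D⁻¹ * Q')⁻¹)).trace :=
  polarization_resolventFamily_eq_cov D P Q Q' S₀ Qc hD hc e C hQC hCC hQQ hΓ _ _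

end Summit.QuantumFields.BalabanUV.Beta.GAN24.ResolventFamilyPolarization

end
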